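import Summits.Ventures.PercRepro.ProfilePointedCircuitClassesStarSharpPencilH

/-!
# PercRepro — THE PENCIL THROUGH `ℓ ∈ X`, PART I: THE F-CLASS — TWO POINTS ON `ef`, AND THE FREE BI-BASES AT A RICH POINT
(p5, gen 56; `proofs/P5-GM1.md` §83)

Two points `a, a′` of `P_f` on the line `ef` carry at most one bad demand with `ℓ` (`pencilX_F_not_both_la`: both
would be B1 defects, `e ∈ cl(X − ℓ − a) ∩ cl(X − ℓ − a′)`, so `cl(X − ℓ − a − a′) + e` would have rank `≤ 2` and
`f ∈ cl{e, a}` would kill the rank-4 condition of the other demand).  A RICH point `a` of `P_f` — off the line `eℓ`,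
off the line `ef`, the other point `a′` of `P_f` off `eℓ` — gives a free bi-basis `{a, c} + e + f` for every point
`c` of `X` off `P_f` (`pencilX_F_rich_free_mem`), hence two of them (`pencilX_F_two_le_card_free_F`).
-/

open scoped Matroid

namespace PercRepro.Cogirth

open Finset ThmH Skew Shadow Profile

open Classical

variable {α : Type} [DecidableEq α] {N : Matroid α} [N.Finite]

section StarSharpPencilI

variable {b b' : α}

/-- `(X ∖ {ℓ, a, a′}) + e ⊆ ((X ∖ {ℓ, a}) + e) ∩ ((X ∖ {ℓ, a′}) + e)`. -/
theorem insert_e_sdiff_triple_subset_inter (X : Finset α) (e l a a' : α) :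
    insert e (X \ {l, a, a'}) ⊆ insert e (X \ {l, a}) ∩ insert e (X \ {l, a'}) := by
  intro z hz
  simp only [mem_insert, mem_sdiff, mem_inter, mem_singleton, not_or] at hz ⊢
  tauto

/-- `(X − ℓ) + e ⊆ ((X ∖ {ℓ, a}) + e) ∪ ((X ∖ {ℓ, a′}) + e)` for `a ≠ a′`. -/
theorem insert_e_erase_subset_union_sdiff (X : Finset α) (e l : α) {a a' : α} (haa' : a ≠ a') :
    insert e (X.erase l) ⊆ insert e (X \ {l, a}) ∪ insert e (X \ {l, a'}) := by
  intro z hz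
  simp only [mem_insert, mem_erase, mem_sdiff, mem_union, mem_singleton, not_or] at hz ⊢
  rcases hz with rfl | ⟨hzl, hz⟩
  · exact Or.inl (Or.inl rfl)
  · by_cases hza : z = a
    · subst hza; exact Or.inr (Or.inr ⟨hz, hzl, haa'⟩)
    · exact Or.inl (Or.inr ⟨hz, hzl, hza⟩)

/-- `(X ∖ {ℓ, a′}) + f ⊆ (X ∖ {ℓ, a, a′}) + e + a + f`. -/
theorem insert_f_sdiff_pair_subset (X : Finset α) (e f l a a' : α) :
    insert f (X \ {l, a'}) ⊆ insert f (insert a (insert e (X \ {l, a, a'}))) := by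
  intro z hz
  simp only [mem_insert, mem_sdiff, mem_singleton, not_or] at hz ⊢
  rcases hz with rfl | ⟨hz, hzl, hza'⟩
  · exact Or.inl rfl
  · by_cases hza : z = a
    · exact Or.inr (Or.inl hza)
    · exact Or.inr (Or.inr (Or.inr ⟨hz, hzl, hza, hza'⟩))

/-- **TWO POINTS OF `P_f` ON THE LINE `ef` CARRY AT MOST ONE BAD DEMAND WITH `ℓ`.** -/
theorem pencilX_F_not_both_la (hn : (gr N).card = 9) (h : SeriesPair N b b') {e f : α} (he : e ∈ gr N)
    (hf : f ∈ gr N) (hef : e ≠ f) (heb : e ≠ b) (heb' : e ≠ b') (hfb : f ≠ b) (hfb' : f ≠ b')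
    (he1 : ∀ y ∈ ((((gr N).erase b).erase b').erase f).erase e, rk N {e, y} = 2)
    (hf1 : ∀ y ∈ ((((gr N).erase b).erase b').erase f).erase e, rk N {f, y} = 2)
    (hfc : ∀ y ∈ ((((gr N).erase b).erase b').erase f).erase e, rk N (((((gr N).erase b).erase b').erase f).erase y) = 4)
    {l : α} (hlX : l ∈ ((((gr N).erase b).erase b').erase f).erase e) (hlon : rk N (insert b (insert b' {e, l})) = 3)
    (hefl : rk N {e, f, l} = 3)
    {a a' : α} (haX : a ∈ ((((gr N).erase b).erase b').erase f).erase e)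
    (ha'X : a' ∈ ((((gr N).erase b).erase b').erase f).erase e) (haa' : a ≠ a') (hal : a ≠ l) (ha'l : a' ≠ l)
    (haP : rk N (insert a {e, f, l}) = 3) (ha'P : rk N (insert a' {e, f, l}) = 3)
    (hefa : rk N {e, f, a} = 2) (hefa' : rk N {e, f, a'} = 2)
    (hWa : insert b (insert e {l, a}) ∈ d0DON N b' e f) (hc0a : ¬ d0c0 N b b' e f (insert b (insert e {l, a})))
    (hWa' : insert b (insert e {l, a'}) ∈ d0DON N b' e f)
    (hc0a' : ¬ d0c0 N b b' e f (insert b (insert e {l, a'}))) : False := by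
  set X := ((((gr N).erase b).erase b').erase f).erase e with hXdef
  have hXg : X ⊆ gr N :=
    (erase_subset _ _).trans ((erase_subset _ _).trans ((erase_subset _ _).trans (erase_subset _ _)))
  have hlP : rk N (insert l {e, f, l}) = 3 := by
    rw [insert_eq_of_mem (mem_insert_of_mem (mem_insert_of_mem (mem_singleton_self _)))]; exact hefl
  have hda := d0DON_pair_data hn h he hf hef heb heb' hfb hfb' hlX haX hWa
  have hτ3a : rk N (X \ {l, a}) = 3 := hda.2.2.1
  have hda' := d0DON_pair_data hn h he hf hef heb heb' hfb hfb' hlX ha'X hWa'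
  have hYfa' : rk N (insert f (X \ {l, a'})) = 4 := hda'.2.1
  have hτ3a' : rk N (X \ {l, a'}) = 3 := hda'.2.2.1
  have hBa := pencilX_F_B1_or_B2 hn h he hf hef heb heb' hfb hfb' he1 hlX hlon hefl hlX haX hal.symm hlP haP hWa hc0a
  have hBa' := pencilX_F_B1_or_B2 hn h he hf hef heb heb' hfb hfb' he1 hlX hlon hefl hlX ha'X ha'l.symm hlP ha'P
    hWa' hc0a'
  -- no B2 defect on the line `ef`
  have hnB2 : ∀ x ∈ X, rk N {e, f, x} = 2 → ¬ rk N (insert f {l, x}) = 2 := by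
    intro x hxX hefx hB2
    have hsm := rk_union_add_rk_le_of_subset_inter' (N := N) (S := insert f {l, x}) (T := {e, f, x}) (I := {f, x})
      (pair_fa_subset_inter_lfa_efa e f l x)
    have h5 : rk N {e, f, l} ≤ rk N (insert f {l, x} ∪ {e, f, x}) := rk_mono' (efl_subset_union_lfa_efa e f l x)
    rw [hB2, hefx, hf1 x hxX] at hsm
    rw [hefl] at h5
    omega
  have hB1a : rk N (insert e (X \ {l, a})) = 3 := hBa.resolve_left (hnB2 a haX hefa)
  have hB1a' : rk N (insert e (X \ {l, a'})) = 3 := hBa'.resolve_left (hnB2 a' ha'X hefa')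
  -- submodularity: `(X ∖ {ℓ, a, a′}) + e` has rank `≤ 2`
  have hsm := rk_union_add_rk_le_of_subset_inter' (N := N) (S := insert e (X \ {l, a})) (T := insert e (X \ {l, a'}))
    (I := insert e (X \ {l, a, a'})) (insert_e_sdiff_triple_subset_inter X e l a a')
  have hU : rk N (insert e (X.erase l)) ≤ rk N (insert e (X \ {l, a}) ∪ insert e (X \ {l, a'})) :=
    rk_mono' (insert_e_erase_subset_union_sdiff X e l haa')
  have hYe : rk N (insert e (X.erase l)) = 4 := by
    have := hfc l hlX
    rw [E7_erase_f_erase_eq_insert_e he hef heb heb' hlX] at this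
    exact this
  rw [hB1a, hB1a'] at hsm
  rw [hYe] at hU
  have hI2 : rk N (insert e (X \ {l, a, a'})) ≤ 2 := by omega
  -- `f ∈ cl{e, a}`, so `(X ∖ {ℓ, a′}) + f` has rank `≤ 3`
  have hfcl : rk N (insert f {e, a}) = rk N {e, a} := by rw [insert_f_ea_eq, hefa, he1 a haX]
  have hsub : ({e, a} : Finset α) ⊆ insert a (insert e (X \ {l, a, a'})) :=
    insert_subset (mem_insert_of_mem (mem_insert_self _ _)) (singleton_subset_iff.2 (mem_insert_self _ _))
  have h6 := rk_insert_eq_of_rk_insert_eq_subset' (N := N) hsub hfcl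
  have h7 := rk_insert_le_add_one (N := N) (hXg haX) (X := insert e (X \ {l, a, a'}))
    (insert_subset he (sdiff_subset.trans hXg))
  have h8 : rk N (insert f (X \ {l, a'})) ≤ rk N (insert f (insert a (insert e (X \ {l, a, a'})))) :=
    rk_mono' (insert_f_sdiff_pair_subset X e f l a a')
  rw [h6] at h8
  rw [hYfa'] at h8
  omega

/-- `{e, f, a} + c = {a, c} + e + f`. -/
theorem insert_c_efa_eq (e f a c : α) : insert c ({e, f, a} : Finset α) = insert f (insert e {a, c}) := by
  ext z; simp only [mem_insert, mem_singleton]; tauto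

/-- `{e, f, ℓ} + c ⊆ {e, f, a} + ℓ + c`. -/
theorem insert_c_efl_subset_insert_c_insert_l_efa (e f l a c : α) :
    insert c ({e, f, l} : Finset α) ⊆ insert c (insert l {e, f, a}) := by
  intro z hz; simp only [mem_insert, mem_singleton] at hz ⊢; tauto

/-- `{ℓ, a} + e ⊆ {e, f, ℓ} + a`. -/
theorem insert_e_la_subset_insert_a_efl (e f l a : α) :
    insert e ({l, a} : Finset α) ⊆ insert a {e, f, l} := by
  intro z hz; simp only [mem_insert, mem_singleton] at hz ⊢; tauto

/-- `{ℓ, a} + e ⊆ {a, c} + e + ℓ`. -/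
theorem insert_e_la_subset_insert_l_e_ac (e l a c : α) :
    insert e ({l, a} : Finset α) ⊆ insert l (insert e {a, c}) := by
  intro z hz; simp only [mem_insert, mem_singleton] at hz ⊢; tauto

/-- `{e, f, ℓ} + c ⊆ {e, f, ℓ} + a + c`. -/
theorem insert_c_efl_subset_insert_c_insert_a (e f l a c : α) :
    insert c ({e, f, l} : Finset α) ⊆ insert c (insert a {e, f, l}) := by
  intro z hz; simp only [mem_insert, mem_singleton] at hz ⊢; tauto

/-- **A RICH POINT OF `P_f` GIVES A FREE BI-BASIS WITH EVERY POINT OFF `P_f`**: `a ∈ P_f` off the lines `eℓ` and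
`ef`, the only other point `a′` of `X − ℓ` on `P_f` off the line `eℓ`, and `c ∈ X` off `P_f`; then `{a, c} + e + f`
is a free bi-basis of the F-class (its complement `{ℓ, a′, d}` is OFF, its pair `{a, c} + e` is not ON). -/
theorem pencilX_F_rich_free_mem (hn : (gr N).card = 9) (h : SeriesPair N b b') {e f : α} (he : e ∈ gr N)
    (hf : f ∈ gr N) (hef : e ≠ f) (heb : e ≠ b) (heb' : e ≠ b') (hfb : f ≠ b) (hfb' : f ≠ b')
    (he1 : ∀ y ∈ ((((gr N).erase b).erase b').erase f).erase e, rk N {e, y} = 2) (heb3 : rk N {e, b, b'} = 3)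
    (hbg : ∀ y ∈ ((((gr N).erase b).erase b').erase f).erase e, rk N {y, b, b'} = 3)
    {l : α} (hlX : l ∈ ((((gr N).erase b).erase b').erase f).erase e) (hlon : rk N (insert b (insert b' {e, l})) = 3)
    (hefl : rk N {e, f, l} = 3)
    {a a' : α} (haX : a ∈ ((((gr N).erase b).erase b').erase f).erase e)
    (ha'X : a' ∈ ((((gr N).erase b).erase b').erase f).erase e) (haa' : a ≠ a') (hal : a ≠ l) (ha'l : a' ≠ l)
    (haP : rk N (insert a {e, f, l}) = 3) (ha'P : rk N (insert a' {e, f, l}) = 3)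
    (haL : rk N (insert e {l, a}) = 3) (ha'L : rk N (insert e {l, a'}) = 3) (hefa : rk N {e, f, a} = 3)
    (hA : ∀ x ∈ ((((gr N).erase b).erase b').erase f).erase e, x ≠ l → rk N (insert x {e, f, l}) = 3 →
      x = a ∨ x = a')
    {c : α} (hcX : c ∈ ((((gr N).erase b).erase b').erase f).erase e) (hcl : c ≠ l) (hca : c ≠ a) (hca' : c ≠ a') :
    insert f (insert e {a, c}) ∈ (biIndepSets N 4).filter (fun B =>
      (((f ∈ B ∧ b' ∉ B) ∧ (e ∈ B ∧ b ∉ B)) ∧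
        ¬ (insert b (B.erase f) ∈ biIndepSets N 4 ∧ rk N (insert b (insert b' (B.erase f))) = 4)) ∧
      ¬ (l ∉ B ∧ ∀ z ∈ (B.erase e).erase f, rk N (insert f (insert e {l, z})) = 4)) := by
  set X := ((((gr N).erase b).erase b').erase f).erase e with hXdef
  have hXE : X ⊆ ((gr N).erase b).erase b' := (erase_subset _ _).trans (erase_subset _ _)
  have hXg : X ⊆ gr N := hXE.trans ((erase_subset _ _).trans (erase_subset _ _))
  have heE : e ∈ ((gr N).erase b).erase b' := mem_erase.2 ⟨heb', mem_erase.2 ⟨heb, he⟩⟩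
  have hefl_sub : ({e, f, l} : Finset α) ⊆ gr N :=
    insert_subset he (insert_subset hf (singleton_subset_iff.2 (hXg hlX)))
  -- a point `x ∈ X` off `{ℓ, a, a′}` is off `P_f`
  have hoffP : ∀ x ∈ X, x ≠ l → x ≠ a → x ≠ a' → rk N (insert x {e, f, l}) = 4 := by
    intro x hxX hxl hxa hxa'
    have h1 : rk N {e, f, l} ≤ rk N (insert x {e, f, l}) := rk_mono' (subset_insert _ _)
    have h2 := rk_insert_le_add_one (N := N) (hXg hxX) (X := ({e, f, l} : Finset α)) hefl_sub
    have h3 : ¬ rk N (insert x {e, f, l}) = 3 := fun h' => by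
      rcases hA x hxX hxl h' with h'' | h''
      · exact hxa h''
      · exact hxa' h''
    rw [hefl] at h1 h2
    omega
  have hcP : rk N (insert c {e, f, l}) = 4 := hoffP c hcX hcl hca hca'
  -- `ℓ ∈ cl{e, f, a}`
  have hlcl : rk N (insert l {e, f, a}) = rk N {e, f, a} := by
    have hsub : ({e, f, a} : Finset α) ⊆ insert a {e, f, l} := by
      intro z hz; simp only [mem_insert, mem_singleton] at hz ⊢; tauto
    exact rk_insert_eq_of_subset_rk_eq hsub (by rw [haP, hefa])
      (by rw [insert_eq_of_mem (mem_insert_of_mem (mem_insert_of_mem (mem_insert_of_mem (mem_singleton_self _))))])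
  -- `{a, c} + e + f` has rank 4
  have h4 : rk N (insert f (insert e {a, c})) = 4 := by
    rw [← insert_c_efa_eq]
    by_contra hne
    have h1 : rk N {e, f, a} ≤ rk N (insert c {e, f, a}) := rk_mono' (subset_insert _ _)
    have h2 := rk_insert_le_add_one (N := N) (hXg hcX) (X := ({e, f, a} : Finset α))
      (insert_subset he (insert_subset hf (singleton_subset_iff.2 (hXg haX))))
    rw [hefa] at h1 h2
    have hccl : rk N (insert c {e, f, a}) = rk N {e, f, a} := by rw [hefa]; omega
    have h3 := rk_insert_eq_of_rk_insert_eq_subset' (N := N) (S := {e, f, a}) (S' := insert l {e, f, a})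
      (subset_insert _ _) hccl
    rw [hlcl, hefa] at h3
    have h5 : rk N (insert c {e, f, l}) ≤ rk N (insert c (insert l {e, f, a})) :=
      rk_mono' (insert_c_efl_subset_insert_c_insert_l_efa e f l a c)
    rw [h3, hcP] at h5
    omega
  -- the fourth point `d` of `X ∖ {ℓ, a, a′}`
  have hZc : (X \ {l, a, a'}).card = 2 := by
    rw [card_sdiff_of_subset, card_X_eq_five hn h he hf hef heb heb' hfb hfb']
    · rw [card_insert_of_notMem, card_pair haa']
      simp only [mem_insert, mem_singleton, not_or]; exact ⟨hal.symm, ha'l.symm⟩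
    · intro z hz; simp only [mem_insert, mem_singleton] at hz
      rcases hz with rfl | rfl | rfl
      · exact hlX
      · exact haX
      · exact ha'X
  have hcZ : c ∈ X \ {l, a, a'} := mem_sdiff.2 ⟨hcX, by
    simp only [mem_insert, mem_singleton, not_or]; exact ⟨hcl, hca, hca'⟩⟩
  obtain ⟨d, hdc, hdZ, -⟩ := pair_eq_insert_of_mem hZc hcZ
  have hdX : d ∈ X := (mem_sdiff.1 hdZ).1
  have hd : d ∉ ({l, a, a'} : Finset α) := (mem_sdiff.1 hdZ).2
  simp only [mem_insert, mem_singleton, not_or] at hd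
  obtain ⟨hdl, hda, hda'⟩ := hd
  have hdP : rk N (insert d {e, f, l}) = 4 := hoffP d hdX hdl hda hda'
  -- the complement `S = X ∖ {a, c} ∋ ℓ, a′, d`
  have hlS : l ∈ X \ {a, c} := mem_sdiff.2 ⟨hlX, by
    simp only [mem_insert, mem_singleton, not_or]; exact ⟨hal.symm, hcl.symm⟩⟩
  have ha'S : a' ∈ X \ {a, c} := mem_sdiff.2 ⟨ha'X, by
    simp only [mem_insert, mem_singleton, not_or]; exact ⟨haa'.symm, hca'.symm⟩⟩
  have hdS : d ∈ X \ {a, c} := mem_sdiff.2 ⟨hdX, by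
    simp only [mem_insert, mem_singleton, not_or]; exact ⟨hda, hdc⟩⟩
  have hSE : X \ {a, c} ⊆ ((gr N).erase b).erase b' := sdiff_subset.trans hXE
  have hac : a ≠ c := hca.symm
  -- `d ∉ cl{e, ℓ, a′}`
  have hdcl : rk N (insert d (insert e {l, a'})) = 4 := by
    by_contra hne
    have h1 : rk N (insert e {l, a'}) ≤ rk N (insert d (insert e {l, a'})) := rk_mono' (subset_insert _ _)
    have h2 := rk_insert_le_add_one (N := N) (hXg hdX) (X := insert e ({l, a'} : Finset α))
      (insert_subset he (insert_subset (hXg hlX) (singleton_subset_iff.2 (hXg ha'X))))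
    rw [ha'L] at h1 h2
    have hdcl' : rk N (insert d (insert e {l, a'})) = rk N (insert e {l, a'}) := by rw [ha'L]; omega
    have h3 := rk_insert_eq_of_rk_insert_eq_subset' (N := N) (S := insert e {l, a'}) (S' := insert a' {e, f, l})
      (insert_e_la_subset_insert_a_efl e f l a') hdcl'
    rw [ha'P] at h3
    have h5 : rk N (insert d {e, f, l}) ≤ rk N (insert d (insert a' {e, f, l})) :=
      rk_mono' (insert_c_efl_subset_insert_c_insert_a e f l a' d)
    rw [h3, hdP] at h5
    omega
  have heS4 : rk N (insert e (X \ {a, c})) = 4 := by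
    have h1 : rk N (insert d (insert e {l, a'})) ≤ rk N (insert e (X \ {a, c})) := by
      apply rk_mono'
      intro z hz
      simp only [mem_insert, mem_singleton] at hz
      rcases hz with rfl | rfl | rfl | rfl
      · exact mem_insert_of_mem hdS
      · exact mem_insert_self _ _
      · exact mem_insert_of_mem hlS
      · exact mem_insert_of_mem ha'S
    have h2 := rk_le_card' (M := N) (insert e (X \ {a, c}))
    have h3 := card_insert_le e (X \ {a, c})
    have h5 : (X \ {a, c}).card = 3 := by
      rw [card_sdiff_of_subset (insert_subset haX (singleton_subset_iff.2 hcX)),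
        card_X_eq_five hn h he hf hef heb heb' hfb hfb', card_pair hac]
    rw [hdcl] at h1
    omega
  have hS3 : rk N (X \ {a, c}) = 3 := by
    have h1 := rk_insert_le_add_one (N := N) he (X := X \ {a, c}) (sdiff_subset.trans hXg)
    have h2 := rk_le_card' (M := N) (X \ {a, c})
    have h5 : (X \ {a, c}).card = 3 := by
      rw [card_sdiff_of_subset (insert_subset haX (singleton_subset_iff.2 hcX)),
        card_X_eq_five hn h he hf hef heb heb' hfb hfb', card_pair hac]
    rw [heS4] at h1
    omega
  have hoff : rk N (insert b (insert b' (X \ {a, c}))) = 5 := by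
    apply rk_insert_bb'_eq_five_of_not_on h hSE hS3
    intro h4'
    have hon : rk N (insert b (insert b' (X \ {a, c}))) = rk N (X \ {a, c}) + 1 := by rw [h4', hS3]
    rw [on_iff_of_line_le h he heb heb' he1 hbg hlX hlon hSE hlS, hS3, heS4] at hon
    omega
  -- the pair `{a, c} + e` is not ON
  have hac3 : rk N (insert e {a, c}) = 3 := by
    have h1 := rk_insert_le_add_one (N := N) hf (X := insert e ({a, c} : Finset α))
      (insert_subset he (insert_subset (hXg haX) (singleton_subset_iff.2 (hXg hcX))))
    have h2 := rk_le_card' (M := N) (insert e ({a, c} : Finset α))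
    have h3 := card_insert_le e ({a, c} : Finset α)
    have h5 := card_le_two (a := a) (b := c)
    rw [h4] at h1
    omega
  have hnon : ¬ rk N (insert b (insert b' (insert e {a, c}))) = 4 := by
    intro hon4
    have hon : rk N (insert b (insert b' (insert e {a, c}))) = rk N (insert e {a, c}) + 1 := by rw [hon4, hac3]
    have hacE : insert e ({a, c} : Finset α) ⊆ ((gr N).erase b).erase b' :=
      insert_subset heE (insert_subset (hXE haX) (singleton_subset_iff.2 (hXE hcX)))
    rw [on_iff_of_line_el h he he1 heb3 hlX hlon hacE (mem_insert_self _ _), hac3] at hon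
    -- `c ∈ cl{e, ℓ, a}`
    have hccl : rk N (insert c (insert e {l, a})) = rk N (insert e {l, a}) :=
      rk_insert_eq_of_subset_rk_eq (insert_e_la_subset_insert_l_e_ac e l a c) (by rw [hon, haL])
        (by rw [insert_eq_of_mem (mem_insert_of_mem (mem_insert_of_mem (mem_insert_of_mem (mem_singleton_self _))))])
    have h3 := rk_insert_eq_of_rk_insert_eq_subset' (N := N) (S := insert e {l, a}) (S' := insert a {e, f, l})
      (insert_e_la_subset_insert_a_efl e f l a) hccl
    rw [haP] at h3
    have h5 : rk N (insert c {e, f, l}) ≤ rk N (insert c (insert a {e, f, l})) :=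
      rk_mono' (insert_c_efl_subset_insert_c_insert_a e f l a c)
    rw [h3, hcP] at h5
    omega
  have hq := free_bibasis_mem hn h he hf hef heb heb' hfb hfb' haX hcX hac h4 hoff hnon
  simp only [mem_filter] at hq ⊢
  refine ⟨hq.1, hq.2, ?_⟩
  rintro ⟨-, hall⟩
  have hae : a ≠ e := (mem_erase.1 haX).1
  have haf : a ≠ f := (mem_erase.1 (mem_erase.1 haX).2).1
  have hce : c ≠ e := (mem_erase.1 hcX).1
  have hcf : c ≠ f := (mem_erase.1 (mem_erase.1 hcX).2).1
  rw [erase_erase_insert_f_insert_e hae haf hce hcf] at hall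
  have := hall a (mem_insert_self _ _)
  rw [← insert_a_efl_eq, haP] at this
  omega

/-- **A RICH POINT GIVES TWO FREE BI-BASES OF THE F-CLASS.** -/
theorem pencilX_F_two_le_card_free_F (hn : (gr N).card = 9) (h : SeriesPair N b b') {e f : α} (he : e ∈ gr N)
    (hf : f ∈ gr N) (hef : e ≠ f) (heb : e ≠ b) (heb' : e ≠ b') (hfb : f ≠ b) (hfb' : f ≠ b')
    (he1 : ∀ y ∈ ((((gr N).erase b).erase b').erase f).erase e, rk N {e, y} = 2) (heb3 : rk N {e, b, b'} = 3)
    (hbg : ∀ y ∈ ((((gr N).erase b).erase b').erase f).erase e, rk N {y, b, b'} = 3)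
    {l : α} (hlX : l ∈ ((((gr N).erase b).erase b').erase f).erase e) (hlon : rk N (insert b (insert b' {e, l})) = 3)
    (hefl : rk N {e, f, l} = 3)
    {a a' : α} (haX : a ∈ ((((gr N).erase b).erase b').erase f).erase e)
    (ha'X : a' ∈ ((((gr N).erase b).erase b').erase f).erase e) (haa' : a ≠ a') (hal : a ≠ l) (ha'l : a' ≠ l)
    (haP : rk N (insert a {e, f, l}) = 3) (ha'P : rk N (insert a' {e, f, l}) = 3)
    (haL : rk N (insert e {l, a}) = 3) (ha'L : rk N (insert e {l, a'}) = 3) (hefa : rk N {e, f, a} = 3)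
    (hA : ∀ x ∈ ((((gr N).erase b).erase b').erase f).erase e, x ≠ l → rk N (insert x {e, f, l}) = 3 →
      x = a ∨ x = a') :
    2 ≤ ((biIndepSets N 4).filter (fun B =>
      (((f ∈ B ∧ b' ∉ B) ∧ (e ∈ B ∧ b ∉ B)) ∧
        ¬ (insert b (B.erase f) ∈ biIndepSets N 4 ∧ rk N (insert b (insert b' (B.erase f))) = 4)) ∧
      ¬ (l ∉ B ∧ ∀ z ∈ (B.erase e).erase f, rk N (insert f (insert e {l, z})) = 4))).card := by
  set X := ((((gr N).erase b).erase b').erase f).erase e with hXdef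
  have hZc : (X \ {l, a, a'}).card = 2 := by
    rw [card_sdiff_of_subset, card_X_eq_five hn h he hf hef heb heb' hfb hfb']
    · rw [card_insert_of_notMem, card_pair haa']
      simp only [mem_insert, mem_singleton, not_or]; exact ⟨hal.symm, ha'l.symm⟩
    · intro z hz; simp only [mem_insert, mem_singleton] at hz
      rcases hz with rfl | rfl | rfl
      · exact hlX
      · exact haX
      · exact ha'X
  obtain ⟨c, d, hcd, hZeq⟩ := card_eq_two.1 hZc
  have hcZ : c ∈ X \ {l, a, a'} := by rw [hZeq]; exact mem_insert_self _ _
  have hdZ : d ∈ X \ {l, a, a'} := by rw [hZeq]; exact mem_insert_of_mem (mem_singleton_self _)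
  have hcX : c ∈ X := (mem_sdiff.1 hcZ).1
  have hc := (mem_sdiff.1 hcZ).2
  simp only [mem_insert, mem_singleton, not_or] at hc
  have hdX : d ∈ X := (mem_sdiff.1 hdZ).1
  have hd := (mem_sdiff.1 hdZ).2
  simp only [mem_insert, mem_singleton, not_or] at hd
  have hBc := pencilX_F_rich_free_mem hn h he hf hef heb heb' hfb hfb' he1 heb3 hbg hlX hlon hefl haX ha'X haa' hal
    ha'l haP ha'P haL ha'L hefa hA hcX hc.1 hc.2.1 hc.2.2
  have hBd := pencilX_F_rich_free_mem hn h he hf hef heb heb' hfb hfb' he1 heb3 hbg hlX hlon hefl haX ha'X haa' hal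
    ha'l haP ha'P haL ha'L hefa hA hdX hd.1 hd.2.1 hd.2.2
  have hne : insert f (insert e ({a, c} : Finset α)) ≠ insert f (insert e {a, d}) := by
    intro heq
    have hmem : c ∈ insert f (insert e ({a, d} : Finset α)) := by
      rw [← heq]
      exact mem_insert_of_mem (mem_insert_of_mem (mem_insert_of_mem (mem_singleton_self _)))
    simp only [mem_insert, mem_singleton] at hmem
    rcases hmem with h' | h' | h' | h'
    · exact (mem_erase.1 (mem_erase.1 hcX).2).1 h'
    · exact (mem_erase.1 hcX).1 h'
    · exact hc.2.1 h'
    · exact hcd h'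
  calc 2 = ({insert f (insert e ({a, c} : Finset α)), insert f (insert e {a, d})} : Finset (Finset α)).card :=
        (card_pair hne).symm
    _ ≤ _ := by
        apply card_le_card
        intro B hB
        simp only [mem_insert, mem_singleton] at hB
        rcases hB with rfl | rfl
        · exact hBc
        · exact hBd

end StarSharpPencilI

end PercRepro.Cogirth
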